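import Summits.BirchSwinnertonDyer.BirchSwinnertonDyer.Theorems.GenusKolyvaginAtTwoPowDvdShaCardAtTwoRTInvariantRung
import Summits.BirchSwinnertonDyer.BirchSwinnertonDyer.Theorems.GenusKolyvaginAtTwoPowDvdShaCardAtTwoRTKolyvaginClassOrder
import Summits.BirchSwinnertonDyer.BirchSwinnertonDyer.Theorems.GenusKolyvaginAtTwoVisiblePairAtTwoKolyvaginClassSign
import Summits.BirchSwinnertonDyer.BirchSwinnertonDyer.Theorems.ByReductionTypeAtTwoRankOneAtTwoBigImageOddLocalOneDoorBottomLemma43AtTwo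
import Literature.NumberTheory.EllipticCurves.HeegnerPointsKolyvaginClassesPointsProofs
import HarnessLib

/-!
# Route `GenusKolyvaginAtTwo`, LINE 18 `plus_descent` on L_T `PowDvdShaCardAtTwoRT` (stmt-BirchSwinnertonDyer-23242), stub 3a⁗ —
# THE PRIME-LEVEL RANK-ZERO READING, assembled: a `2`-primitive derived point at a PRIME Kolyvagin level `ℓ` whose class `c_{M}(ℓ)` is
# Selmer over `K` gives `2M − 2 ≤ ord₂ #Ш(E/ℚ)[2^∞]`

Seat `bsd-line-gk2-p1` g14 (LEAD seat 1/3, cell `bsd-f1-sign2`), `--supports stmt-BirchSwinnertonDyer-23242 --as helper`.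
THEOREMS ONLY (no definition, no named fact, no `sorry`).  Nothing here closes an item; BSD is not proved by any of this.

Composition of this session's bricks with gk2-p3's: ORDER (`addOrderOf_kolyvaginClass_two_eq_pow_of_not_two_dvd`: `P(ℓ) ∉ 2E(K[ℓ]) ⟹
ord c_M(ℓ) = 2^M`), SIGN (gk2-p3 `KolyvaginClassSign.sign_conjAct_kolyvaginClass_two`: `τ·c_M(ℓ) = w(E)·c_M(ℓ)` at a prime level, so
`τ`-INVARIANT for `w(E) = +1`), DESCENT + ONE-BIT RUNG (`two_mul_sub_one_le_padicValNat_sha_of_invariant_selmer_class`).  Result: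

* **`two_mul_sub_one_le_padicValNat_sha_of_primitive_prime_level`** — on the frame (`W` globally minimal with `Δ < 0`, `ρ̄_{E,2}` onto,
  `w(E) = +1`, `rank E(ℚ) = 0`, `Ш(E/ℚ)[2^∞]` finite; `K` imaginary quadratic with odd `d_K ≠ −3` and the Heegner hypothesis; `ℓ` a
  Kolyvagin prime at `2` of index `≥ M ≥ 1`; Kolyvagin–Heegner data at `1` and `ℓ`), IF `P(ℓ) ∉ 2E(K[ℓ])` (the crux's `hPn` at `n = ℓ`)
  AND `c_M(ℓ) ∈ Sel^{(2^M)}(E_K/K)` (the displayed arithmetic input: McCallum's Lemma 4.3 over `K` off `ℓ` + the Kolyvagin relation Q2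
  at `λ ∣ ℓ` with `2^M ∣ y_K`), THEN **`2(M − 1) ≤ ord₂ #Ш(E/ℚ)[2^∞]`**.  With `M = M₀` (`2^{M₀} ∥ y_K`): `2M₀ − 2 ≤ ord₂ g`, i.e. 3a⁗'s
  rank-zero share up to the one residual bit isolated in the lead memo (`Cruxes/PowDvdShaCardAtTwoRT/Lines/plus-descent-lead-g14.md`).

References: [McCallumLMS1991] §4 Lemma 4.3, Cor. 4.5, Prop. 4.4, §5 p. 310; [GrossLMS1991] Prop. 5.4, §5 (5.1); [Kolyvagin1989Izv] §3.
-/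

set_option autoImplicit false
-- the Theorems namespace of this sub repeats the summit name by design (D-0017 nested layout)
set_option linter.dupNamespace false

noncomputable section

open scoped Classical

namespace Summit.BirchSwinnertonDyer.BirchSwinnertonDyer.Theorems.GenusExact.PlusDescent

open NumberField WeierstrassCurve Field Literature.NumberTheory.EllipticCurves
  Literature.NumberTheory.EllipticCurves.ModularForms

variable {W : WeierstrassCurve ℚ} [NeZero (W.conductorNorm ℤ)] {K : Type} [Field K] [NumberField K]
  {Dt : ModularParametrizationData W (W.conductorNorm ℤ)} {β : ℤ} {ι : K →+* ℂ}

/-- **THE PRIME-LEVEL RANK-ZERO READING of 3a⁗.**  `W/ℚ` globally minimal elliptic with `Δ < 0`, `ρ̄_{E,2}` onto, root number `+1`,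
`rank E(ℚ) = 0`, `Ш(E/ℚ)[2^∞]` finite; `K` imaginary quadratic with odd `d_K ≠ −3` satisfying the Heegner hypothesis for `N_W`; `ℓ` a
Kolyvagin prime at `2` with `M ≤ M(ℓ)`, `1 ≤ M`; Kolyvagin–Heegner data `d` at the divisors of `ℓ`.  If the derived point is
`2`-PRIMITIVE, `P(ℓ) ∉ 2E(K[ℓ])`, and its class `c_M(ℓ)` is SELMER over `K`, then `2(M − 1) ≤ ord₂ #Ш(E/ℚ)[2^∞]`.
Proof: `ord c_M(ℓ) = 2^M` (`addOrderOf_kolyvaginClass_two_eq_pow_of_not_two_dvd`); `τ·c_M(ℓ) = (−w(E)·(−1)^1)·c_M(ℓ) = c_M(ℓ)`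
(`KolyvaginClassSign.sign_conjAct_kolyvaginClass_two`, `w(E) = 1`); then `two_mul_sub_one_le_padicValNat_sha_of_invariant_selmer_class`.
[cite: McCallumLMS1991, §4 Cor. 4.5 and §5 p. 310] [cite: GrossLMS1991, Prop. 5.4 and §5 (5.1)] [cite: Kolyvagin1989Izv, §3] -/
theorem two_mul_sub_one_le_padicValNat_sha_of_primitive_prime_level [W.IsElliptic] [W.IsGloballyMinimal]
    (hK : IsImaginaryQuadratic K) (hodd : Odd (NumberField.discr K)) (h3 : NumberField.discr K ≠ -3)
    (hH : SatisfiesHeegnerHypothesis (W.conductorNorm ℤ) K) (hsurj : W.HasSurjectiveModNGaloisRep ((2 : ℤ) ^ 1))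
    (hΔ : W.Δ < 0) (hw : W.rootNumber = 1) (hrk : W.mordellWeilRank = 0)
    [Finite (AddCommGroup.primaryComponent W.sha 2)] (τ : K ≃ₐ[ℚ] K) (hτ : τ ≠ 1)
    {ℓ M : ℕ} (hℓ : ℓ.Prime) (hM : 1 ≤ M)
    (hkol : Zhang2014.IsKolyvaginPrime (W.conductorNorm ℤ) W K 2 ℓ ∧ M ≤ Zhang2014.kolyvaginIndex W 2 ℓ)
    (d : (m : ℕ) → m ∣ ℓ → KolyvaginHeegnerData Dt β ι m)
    (hprim : ¬ ∃ Q : (W.baseChange (ringClassField K ι ℓ)).toAffine.Point, (2 : ℤ) • Q = (d ℓ dvd_rfl).derivedPoint)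
    (hsel : (d ℓ dvd_rfl).kolyvaginClass Nat.prime_two M ∈ selmerGroup (W.baseChange K) ((2 ^ M : ℕ) : ℤ)) :
    2 * (M - 1) ≤ padicValNat 2 (Nat.card (AddCommGroup.primaryComponent W.sha 2)) := by
  have hsq : Squarefree ℓ := hℓ.squarefree
  have hkol' : ∀ q ∈ ℓ.primeFactors,
      Zhang2014.IsKolyvaginPrime (W.conductorNorm ℤ) W K 2 q ∧ M ≤ Zhang2014.kolyvaginIndex W 2 q := by
    intro q hq
    rw [hℓ.primeFactors, Finset.mem_singleton] at hq
    subst hq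
    exact hkol
  have hD4 : NumberField.discr K ≠ -4 := by
    intro h
    rw [h] at hodd
    exact (Int.not_even_iff_odd.mpr hodd) ⟨-2, by norm_num⟩
  -- order `2^M`
  have hord := addOrderOf_kolyvaginClass_two_eq_pow_of_not_two_dvd hK hodd h3 hH hsurj hsq hM hkol' d hprim
  -- `τ`-invariance from the sign `−w(E)·(−1)^{#primes of ℓ} = w(E) = 1`
  obtain ⟨-, hsign⟩ := KolyvaginClassSign.sign_conjAct_kolyvaginClass_two hK h3 hD4 hodd hH hsurj τ hτ Dt β ι hsq hM
    hkol' (d ℓ dvd_rfl)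
  have hcard : ℓ.primeFactors.card = 1 := by rw [hℓ.primeFactors, Finset.card_singleton]
  rw [hcard, hw, pow_one, mul_neg_one, neg_neg, one_smul] at hsign
  have hsurj2 : W.HasSurjectiveModNGaloisRep 2 := by simpa using hsurj
  exact two_mul_sub_one_le_padicValNat_sha_of_invariant_selmer_class W hK hΔ hsurj2 hrk τ hτ M hsel hsign hord

/-! ## Append (same seat): the Selmer input reduced to the places above `ℓ` — McCallum's Lemma 4.3 over `K` at `2` is fkl-p1's
tree theorem on the odd-Tamagawa slice (`RankOneAtTwoOneDoor.kolyvaginClass_two_mem_selmerLocalKer_of_odd_tamagawaProduct`, every finite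
`w ∤ n`), and the complex places ask nothing (`mem_selmerLocalKer_infinitePlace_of_isImaginaryQuadratic`).  What remains displayed is the
Selmer condition AT `λ ∣ ℓ` alone — the output of the route's Q2 `KolyvaginRelationAtTwo` at `j = 0` together with `2^M ∣ y_K`
(`c_M(ℓ) ∈ Loc_λ ⟺ c_M(ℓ)_λ = 0 ⟺ c_M(1)_λ = 0`, and `c_M(1) = 0` globally when `2^M ∣ P(1)`, McCallum Cor. 4.5). -/

/-- **THE PRIME-LEVEL RANK-ZERO READING on the odd-Tamagawa habitat, Selmer input at `λ` only.**  `W/ℚ` globally minimal with `Δ < 0`,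
`ρ_{E,2^k}` onto for every `k`, `∏ c_v(W)` odd, root number `+1`, `rank E(ℚ) = 0`, `Ш(E/ℚ)[2^∞]` finite; `K` imaginary quadratic with odd
`d_K ≠ −3` and the Heegner hypothesis; `ℓ` a Kolyvagin prime at `2` with `1 ≤ M ≤ M(ℓ)`; data at the divisors of `ℓ` with `P(ℓ) ∉ 2E(K[ℓ])`.
If `c_M(ℓ)` satisfies the Selmer condition at the place(s) of `K` above `ℓ` (⟸ Q2 + `2^M ∣ y_K`), then **`2(M − 1) ≤ ord₂ #Ш(E/ℚ)[2^∞]`**.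
[cite: McCallumLMS1991, §4 Lemma 4.3, Cor. 4.5, Prop. 4.4 and §5 p. 310] [cite: GrossLMS1991, Prop. 5.4, Prop. 6.2 (1)] [cite: Kolyvagin1989Izv, §3] -/
theorem two_mul_sub_one_le_padicValNat_sha_of_primitive_prime_level_of_odd_tamagawaProduct [W.IsElliptic]
    [W.IsGloballyMinimal] (hK : IsImaginaryQuadratic K) (hodd : Odd (NumberField.discr K)) (h3 : NumberField.discr K ≠ -3)
    (hH : SatisfiesHeegnerHypothesis (W.conductorNorm ℤ) K) (hsurj : ∀ k : ℕ, W.HasSurjectiveModNGaloisRep ((2 ^ k : ℕ) : ℤ))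
    (hT : Odd W.tamagawaProduct) (hΔ : W.Δ < 0) (hw : W.rootNumber = 1) (hrk : W.mordellWeilRank = 0)
    [Finite (AddCommGroup.primaryComponent W.sha 2)] (τ : K ≃ₐ[ℚ] K) (hτ : τ ≠ 1)
    {ℓ M : ℕ} (hℓ : ℓ.Prime) (hM : 1 ≤ M)
    (hkol : Zhang2014.IsKolyvaginPrime (W.conductorNorm ℤ) W K 2 ℓ ∧ M ≤ Zhang2014.kolyvaginIndex W 2 ℓ)
    (d : (m : ℕ) → m ∣ ℓ → KolyvaginHeegnerData Dt β ι m)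
    (hprim : ¬ ∃ Q : (W.baseChange (ringClassField K ι ℓ)).toAffine.Point, (2 : ℤ) • Q = (d ℓ dvd_rfl).derivedPoint)
    (hselℓ : ∀ w : IsDedekindDomain.HeightOneSpectrum (𝓞 K), (ℓ : 𝓞 K) ∈ w.asIdeal →
      (d ℓ dvd_rfl).kolyvaginClass Nat.prime_two M ∈ selmerLocalKer (W.baseChange K) (w.adicCompletion K) ((2 ^ M : ℕ) : ℤ)) :
    2 * (M - 1) ≤ padicValNat 2 (Nat.card (AddCommGroup.primaryComponent W.sha 2)) := by
  have hsq : Squarefree ℓ := hℓ.squarefree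
  have hkol' : ∀ q ∈ ℓ.primeFactors,
      Zhang2014.IsKolyvaginPrime (W.conductorNorm ℤ) W K 2 q ∧ M ≤ Zhang2014.kolyvaginIndex W 2 q := by
    intro q hq
    rw [hℓ.primeFactors, Finset.mem_singleton] at hq
    subst hq
    exact hkol
  have hD4 : NumberField.discr K ≠ -4 := by
    intro h
    rw [h] at hodd
    exact (Int.not_even_iff_odd.mpr hodd) ⟨-2, by norm_num⟩
  have hsurj1 : W.HasSurjectiveModNGaloisRep ((2 : ℤ) ^ 1) := by simpa using hsurj 1
  -- the Selmer condition over `K` at every place: off `ℓ` by fkl-p1's Lemma 4.3 at `2`, at `∞` trivially, at `λ` by hypothesis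
  have hsel : (d ℓ dvd_rfl).kolyvaginClass Nat.prime_two M ∈ selmerGroup (W.baseChange K) ((2 ^ M : ℕ) : ℤ) := by
    rw [mem_selmerGroup_iff]
    refine ⟨fun w ↦ ?_, fun w ↦ mem_selmerLocalKer_infinitePlace_of_isImaginaryQuadratic hK _ w _⟩
    by_cases hw : (ℓ : 𝓞 K) ∈ w.asIdeal
    · exact hselℓ w hw
    · exact RankOneAtTwoOneDoor.kolyvaginClass_two_mem_selmerLocalKer_of_odd_tamagawaProduct W hsurj hT K hK h3 hD4 hH
        Dt β ι M hsq hkol' (d ℓ dvd_rfl) w hw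
  exact two_mul_sub_one_le_padicValNat_sha_of_primitive_prime_level hK hodd h3 hH hsurj1 hΔ hw hrk τ hτ hℓ hM hkol d
    hprim hsel

end Summit.BirchSwinnertonDyer.BirchSwinnertonDyer.Theorems.GenusExact.PlusDescent

end
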